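import Summits.QuantumAdvantage.QuantumAdvantage.Theorems.CubicForrelationNearExactIsExactTwelveZ512SignAffine

/-!
# Crux `CubicForrelation.NearExactIsExact` (stmt-QuantumAdvantage-14043) — n = 12: the level-`≥ 6` × level-`≥ 6` branch of the OPEN
  window `57/64 < Φ < 29/32` is DEAD; two cubics on 12 bits with `W_f, W_g ∈ 64ℤ` have `Φ ≤ 57/64` or `Φ = 1` (tight: `F8ChainTwelve`)

Certificate seat `b2b-cforr-cert` (gen 27).  HONEST FRAMING: a kernel-checked finite-slice theorem (standard axioms; `decide` only on closed
integer/Boolean identities) about cubic Boolean pairs on 12 bits.  It closes ONE of the three branches (level-6 × level-6; the type-O and level-5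
branches below `29/32` remain) of the open window for all sixteen undecided values `913/1024 … 928/1024` at once.  NO new value of `θ₁₂`
(`θ₁₂ ∈ [57/64, 14847/16384]` unchanged); NOT summit progress.

Setting.  Cubic `f, g` on 12 bits with `W_g = 64u''`, `W_f = 64wf` (both sides at level `≥ 6`), `57/64 < Φ < 1`; residuals `e = u'' − (−1)^f`
(x-space) and `e′ = wf − (−1)^g` (y-space); `B := Σe² = Σe′² = 8192(1 − Φ) ≤ 895`.  By gen 26 (`tzw_levelSix_window_Z512`) both even sets
`Z = {u'' even}`, `Z′ = {wf even}` are 9-flats; `e` is odd exactly on `Z`.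

THE ARGUMENT (`tz_levelSix_both_window_false`).
1. (…TwelveZ512SignAffine) The mod-4 sign `σ` of `e` on `Z` is AFFINE (5-flat congruence `gh_flat5` + three avoiding transversal directions),
   so the signed indicator `S = σ·1_Z` has character sums `M(y) = Ŝ(y) ∈ {0, ±512}`, non-zero at exactly `8` frequencies; same for `S′`, `M′`.
2. Duality `ê = −64e′` (`l5k_duality`) and the `ℓ¹` budget `2Σ|e − S| ≤ B − 512 ≤ 383` give, with `s := M/64 ∈ {0, ±8}`:
   `64·|e′(y) + s(y)| = |(e − S)^(y)| ≤ 191`, so `e′ = −s + δ` with `|δ| ≤ 2` everywhere; symmetrically `e = −s′ + δ′`, `|δ′| ≤ 2`.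
3. Parseval for `π = e − S` (`π̂ = −64(e′ + s)`): `Σ_y (e′ + s)² = Σ_x (e − S)²`; symmetrically `Σ_x (e + s′)² = Σ_y (e′ − S′)²`.  Hence
   `Q := Σ_x [(e − S)² − (e + s′)²]` and `Q′ := Σ_y [(e′ − S′)² − (e′ + s)²]` satisfy `Q + Q′ = 0`.
4. Pointwise (a check over the fifteen possible local patterns `s′ ∈ {0, ±8}`, `δ′ ∈ {−2,…,2}`; `tzb_pt_on`, `tzb_pt_off`):
   `2e(x)² − [(e − S)² − (e + s′)²](x) ≥ 3·[x ∈ Z] + 32·[s′(x) ≠ 0]`.  Summing over `x` (`#Z = 512`, `#{s′ ≠ 0} = 8`): `2B − Q ≥ 1792`;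
   likewise `2B − Q′ ≥ 1792`; adding, `4B ≥ 3584`, i.e. `B ≥ 896`, i.e. `Φ ≤ 57/64` — contradiction.
Equality `B = 896` forces `e = ±1` on `Z` off an 8-set where `e = ±7`, `e = 0` off `Z` (both sides): exactly the shape of the record pair
`Negative/F8ChainTwelve` (`Φ = 57/64`), so the bound is tight in this branch.

Main statements: `tz_levelSix_both_window_false`, `tz_levelSix_both_le_5764` (`Φ < 1 ⇒ Φ ≤ 57/64`), `tz_levelSix_both_isolation`
(`Φ > 57/64 ⇒ Φ = 1`).

References: MacWilliams–Sloane (1977) Ch. 13–14; R. O'Donnell (2014) §1.4 (Parseval, Fourier duality); O. Rothaus (1976).  Axioms: the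
standard three.
-/

set_option linter.dupNamespace false -- D-0017: single-problem summit ⇒ `QuantumAdvantage.QuantumAdvantage` by design

noncomputable section

namespace Summit.QuantumAdvantage.QuantumAdvantage.Theorems.CubicForrelation.NearExactIsExact

open Finset
open Literature.Computability.QuantumComplexity
open Literature.Computability.QuantumComplexity.BuzetChailloux (bxor zeroVec bxor_bxor_cancel_left bxor_zeroVec zeroVec_bxor bxor_comm
  bxor_self)
open Literature.Computability.QuantumComplexity.DerivativeWalsh (W sum_W_sq)
open Literature.Computability.QuantumComplexity.Simon (twist_eq_one_or)

/-! ### Pointwise arithmetic -/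

/-- **Pointwise inequality on `Z`** (`e` odd, `S = σ` the mod-4 sign, `s ∈ {0, ±8}`, `|e + s| ≤ 2`):
`3 + 32·[s ≠ 0] ≤ 2e² − ((e − σ)² − (e + s)²)`. [this work] -/
theorem tzb_pt_on (e s : ℤ) (he : Odd e) (hs : s = 0 ∨ s = 8 ∨ s = -8) (hd : |e + s| ≤ 2) :
    3 + 32 * (if s = 0 then (0 : ℤ) else 1) ≤ 2 * e ^ 2 - ((e - sZ (decide (e % 4 = 3))) ^ 2 - (e + s) ^ 2) := by
  have ho := Int.odd_iff.1 he
  have h1 := abs_le.1 hd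
  rcases hs with rfl | rfl | rfl
  · rcases (show e = -1 ∨ e = 1 by omega) with rfl | rfl <;> decide
  · rcases (show e = -9 ∨ e = -7 by omega) with rfl | rfl <;> decide
  · rcases (show e = 7 ∨ e = 9 by omega) with rfl | rfl <;> decide

/-- **Pointwise inequality off `Z`** (`e` even, `S = 0`, `s ∈ {0, ±8}`, `|e + s| ≤ 2`): `32·[s ≠ 0] ≤ 2e² − (e² − (e + s)²)`. [this work] -/
theorem tzb_pt_off (e s : ℤ) (he : Even e) (hs : s = 0 ∨ s = 8 ∨ s = -8) (hd : |e + s| ≤ 2) :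
    32 * (if s = 0 then (0 : ℤ) else 1) ≤ 2 * e ^ 2 - ((e - 0) ^ 2 - (e + s) ^ 2) := by
  have hev := Int.even_iff.1 he
  have h1 := abs_le.1 hd
  rcases hs with rfl | rfl | rfl
  · simp only [if_true]; nlinarith
  · rcases (show e = -10 ∨ e = -8 ∨ e = -6 by omega) with rfl | rfl | rfl <;> decide
  · rcases (show e = 6 ∨ e = 8 ∨ e = 10 by omega) with rfl | rfl | rfl <;> decide

/-- `ℓ¹` versus energy on `Z` at modulus `4`: `σ = ±1`, `4 ∣ e − σ` ⇒ `2|e − σ| ≤ e² − 1`. [folklore] -/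
theorem tzb_l1_on {e σ : ℤ} (hσ : σ = 1 ∨ σ = -1) (h4 : (4 : ℤ) ∣ e - σ) : 2 * |e - σ| ≤ e ^ 2 - 1 := by
  obtain ⟨q, hq⟩ := h4
  have he : e = σ + 4 * q := by linarith
  subst he
  rw [show σ + 4 * q - σ = 4 * q by ring]
  rcases le_or_gt 0 q with hq0 | hq0
  · rw [abs_of_nonneg (by linarith)]
    rcases eq_or_lt_of_le hq0 with h | h
    · subst h; rcases hσ with rfl | rfl <;> norm_num
    · have h1 : (1 : ℤ) ≤ q := h
      rcases hσ with rfl | rfl <;> nlinarith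
  · rw [abs_of_neg (by linarith)]
    have h1 : q ≤ -1 := by omega
    rcases hσ with rfl | rfl <;> nlinarith

/-- `ℓ¹` versus energy off `Z`: `e` even ⇒ `2|e| ≤ e²`. [folklore] -/
theorem tzb_l1_off {e : ℤ} (he : Even e) : 2 * |e - 0| ≤ e ^ 2 - 0 := by
  obtain ⟨q, hq⟩ := he
  subst hq
  rw [sub_zero, sub_zero]
  rcases le_or_gt 0 q with hq0 | hq0
  · rw [abs_of_nonneg (by linarith)]
    rcases eq_or_lt_of_le hq0 with h | h
    · subst h; norm_num
    · have h1 : (1 : ℤ) ≤ q := h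
      nlinarith
  · rw [abs_of_neg (by linarith)]
    have h1 : q ≤ -1 := by omega
    nlinarith

/-! ### The kill -/

/-- **The level-`≥ 6` × level-`≥ 6` branch of the open window is dead** (module docstring): cubic `f, g` on 12 bits with `W_g = 64u''`,
`W_f = 64wf` and `57/64 < Φ(f,g) < 1` do not exist.  Finite-slice statement, NOT summit progress. [this work] -/
theorem tz_levelSix_both_window_false (f g : (Fin (6 + 6) → Bool) → Bool) (hf : IsDegLeFun 3 f) (hg : IsDegLeFun 3 g)
    (u'' : (Fin (6 + 6) → Bool) → ℤ) (hu'' : ∀ x, W (fun y => signOf (g y)) x = (2 : ℝ) ^ 6 * (u'' x : ℝ))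
    (wf : (Fin (6 + 6) → Bool) → ℤ) (hwf : ∀ y, W (fun x => signOf (f x)) y = (2 : ℝ) ^ 6 * (wf y : ℝ))
    (hlo : (57 / 64 : ℝ) < forrelation f g) (hhi : forrelation f g < 1) : False := by
  classical
  have hΦ' : forrelation g f = forrelation f g := by
    rw [Summit.QuantumAdvantage.QuantumAdvantage.Theorems.SignedCubicForrelationNotPrBPP.Negative.HalfQuad.forrelation_comm]
  have hlo' : (57 / 64 : ℝ) < forrelation g f := by rw [hΦ']; exact hlo
  have hhi' : forrelation g f < 1 := by rw [hΦ']; exact hhi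
  -- the two 9-flats
  obtain ⟨V₀, xZ, h0, hadd, hcardV, hS, -⟩ := tzf_levelSix_window_residual f g hf hg u'' hu'' wf hwf hlo hhi
  obtain ⟨V₁, yZ, h1, hadd1, hcardV1, hS1, -⟩ := tzf_levelSix_window_residual g f hg hf wf hwf u'' hu'' hlo' hhi'
  set Z := univ.filter (fun x : Fin (6 + 6) → Bool => ¬ Odd (u'' x)) with hZdef
  set Z' := univ.filter (fun y : Fin (6 + 6) → Bool => ¬ Odd (wf y)) with hZ'def
  have hmemZ : ∀ x, x ∈ Z ↔ ¬ Odd (u'' x) := fun x => by simp [hZdef]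
  have hmemZ' : ∀ y, y ∈ Z' ↔ ¬ Odd (wf y) := fun y => by simp [hZ'def]
  have hZ : #Z = 512 := by rw [hS, card_image_of_injective _ (iw_bxor_injective xZ), hcardV]
  have hZ' : #Z' = 512 := by rw [hS1, card_image_of_injective _ (iw_bxor_injective yZ), hcardV1]
  -- residuals and budgets
  set e : (Fin (6 + 6) → Bool) → ℤ := fun x => u'' x - sZ (f x) with hedef
  set e' : (Fin (6 + 6) → Bool) → ℤ := fun y => wf y - sZ (g y) with he'def
  obtain ⟨hBR, heodd, hoffle⟩ := tzw_budget_split f g u'' hu''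
  obtain ⟨hBR', heodd', hoffle'⟩ := tzw_budget_split g f wf hwf
  have hB : (∑ x, e x ^ 2 : ℤ) ≤ 895 := by
    have h' : ((∑ x, e x ^ 2 : ℤ) : ℝ) < 896 := by rw [hBR]; linarith
    have h'' : (∑ x, e x ^ 2 : ℤ) < 896 := by exact_mod_cast h'
    omega
  have hBB : (∑ y, e' y ^ 2 : ℤ) = ∑ x, e x ^ 2 := by
    have h' : ((∑ y, e' y ^ 2 : ℤ) : ℝ) = ((∑ x, e x ^ 2 : ℤ) : ℝ) := by rw [hBR, hBR', hΦ']
    exact_mod_cast h'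
  rw [hZ] at hoffle
  rw [hZ'] at hoffle'
  have hoff : ∑ x ∈ univ.filter (fun x => x ∉ Z), e x ^ 2 ≤ 511 := by push_cast at hoffle; linarith
  have hoff' : ∑ y ∈ univ.filter (fun y => y ∉ Z'), e' y ^ 2 ≤ 511 := by push_cast at hoffle'; linarith
  have heeven : ∀ x, x ∉ Z → Even (e x) := fun x hx => gh_even_off f u'' x hx
  have he'even : ∀ y, y ∉ Z' → Even (e' y) := fun y hy => gh_even_off g wf y hy
  -- the signs and their character sums
  set hb : (Fin (6 + 6) → Bool) → Bool := fun x => decide (e x % 4 = 3) with hbdef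
  set hb' : (Fin (6 + 6) → Bool) → Bool := fun y => decide (e' y % 4 = 3) with hb'def
  set M : (Fin (6 + 6) → Bool) → ℝ := fun y => ∑ x ∈ Z, signOf (hb x) * twist x y with hMdef
  set M' : (Fin (6 + 6) → Bool) → ℝ := fun x => ∑ y ∈ Z', signOf (hb' y) * twist y x with hM'def
  have hMv : ∀ y, M y = 0 ∨ M y = 512 ∨ M y = -512 :=
    fun y => tza_Shat_vals f g hf hg u'' hu'' V₀ xZ h0 hadd hcardV hS hoff y
  have hM'v : ∀ x, M' x = 0 ∨ M' x = 512 ∨ M' x = -512 :=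
    fun x => tza_Shat_vals g f hg hf wf hwf V₁ yZ h1 hadd1 hcardV1 hS1 hoff' x
  have hMsupp : #(univ.filter fun y => M y ≠ 0) = 8 := tza_Shat_support u'' hb hZ hMv
  have hM'supp : #(univ.filter fun x => M' x ≠ 0) = 8 := tza_Shat_support wf hb' hZ' hM'v
  -- integer scaled character sums `s = M/64 ∈ {0, ±8}`
  set sI : (Fin (6 + 6) → Bool) → ℤ := fun y => if M y = 512 then 8 else if M y = -512 then -8 else 0 with hsIdef
  set sI' : (Fin (6 + 6) → Bool) → ℤ := fun x => if M' x = 512 then 8 else if M' x = -512 then -8 else 0 with hsI'def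
  have hsI : ∀ y, 64 * ((sI y : ℤ) : ℝ) = M y := by
    intro y
    rcases hMv y with h | h | h
    · simp only [sI]; rw [if_neg (by rw [h]; norm_num), if_neg (by rw [h]; norm_num), h]; norm_num
    · simp only [sI]; rw [if_pos h, h]; norm_num
    · simp only [sI]; rw [if_neg (by rw [h]; norm_num), if_pos h, h]; norm_num
  have hsI' : ∀ x, 64 * ((sI' x : ℤ) : ℝ) = M' x := by
    intro x
    rcases hM'v x with h | h | h
    · simp only [sI']; rw [if_neg (by rw [h]; norm_num), if_neg (by rw [h]; norm_num), h]; norm_num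
    · simp only [sI']; rw [if_pos h, h]; norm_num
    · simp only [sI']; rw [if_neg (by rw [h]; norm_num), if_pos h, h]; norm_num
  have hsIv : ∀ y, sI y = 0 ∨ sI y = 8 ∨ sI y = -8 := by
    intro y; simp only [sI]; split_ifs <;> simp
  have hsI'v : ∀ x, sI' x = 0 ∨ sI' x = 8 ∨ sI' x = -8 := by
    intro x; simp only [sI']; split_ifs <;> simp
  have hsI0 : ∀ y, sI y = 0 ↔ M y = 0 := by
    intro y
    constructor
    · intro h; have h2 := hsI y; rw [h] at h2; push_cast at h2; linarith
    · intro h; have h2 := hsI y; rw [h] at h2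
      have : ((sI y : ℤ) : ℝ) = 0 := by linarith
      exact_mod_cast this
  have hsI'0 : ∀ x, sI' x = 0 ↔ M' x = 0 := by
    intro x
    constructor
    · intro h; have h2 := hsI' x; rw [h] at h2; push_cast at h2; linarith
    · intro h; have h2 := hsI' x; rw [h] at h2
      have : ((sI' x : ℤ) : ℝ) = 0 := by linarith
      exact_mod_cast this
  -- the signed indicators `S = σ·1_Z`, `S′ = σ′·1_{Z′}`
  set S : (Fin (6 + 6) → Bool) → ℤ := fun x => if x ∈ Z then sZ (hb x) else 0 with hSdef
  set S' : (Fin (6 + 6) → Bool) → ℤ := fun y => if y ∈ Z' then sZ (hb' y) else 0 with hS'def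
  have hShat : ∀ y, ∑ a, ((S a : ℤ) : ℝ) * twist a y = M y := by
    intro y
    have hres : ∑ a, ((S a : ℤ) : ℝ) * twist a y = ∑ a ∈ Z, ((S a : ℤ) : ℝ) * twist a y := by
      symm
      apply sum_subset (subset_univ Z)
      intro x _ hx
      simp only [S]; rw [if_neg hx]; simp
    rw [hres]
    exact sum_congr rfl fun x hx => by simp only [S]; rw [if_pos hx, tp_sZ_cast]
  have hShat' : ∀ x, ∑ b, ((S' b : ℤ) : ℝ) * twist b x = M' x := by
    intro x
    have hres : ∑ b, ((S' b : ℤ) : ℝ) * twist b x = ∑ b ∈ Z', ((S' b : ℤ) : ℝ) * twist b x := by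
      symm
      apply sum_subset (subset_univ Z')
      intro y _ hy
      simp only [S']; rw [if_neg hy]; simp
    rw [hres]
    exact sum_congr rfl fun y hy => by simp only [S']; rw [if_pos hy, tp_sZ_cast]
  -- duality `ê = −64 e′`, `ê′ = −64 e`
  have hdual : ∀ y, ∑ a, ((e a : ℤ) : ℝ) * twist a y = -64 * ((e' y : ℤ) : ℝ) := by
    intro y
    have h := l5k_duality f g (fun x => 2 * u'' x) (fun x => by rw [hu'']; push_cast; ring) (fun y => 2 * wf y)
      (fun y => by rw [hwf]; push_cast; ring) y
    have e2 : ∑ a, (((2 * u'' a - 2 * sZ (f a) : ℤ)) : ℝ) * twist a y = 2 * ∑ a, ((e a : ℤ) : ℝ) * twist a y := by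
      rw [mul_sum]; exact sum_congr rfl fun a _ => by simp only [e]; push_cast; ring
    rw [e2] at h
    have : ∑ a, ((e a : ℤ) : ℝ) * twist a y = -32 * (((2 * wf y - 2 * sZ (g y) : ℤ)) : ℝ) := by linarith
    rw [this]; simp only [e']; push_cast; ring
  have hdual' : ∀ x, ∑ b, ((e' b : ℤ) : ℝ) * twist b x = -64 * ((e x : ℤ) : ℝ) := by
    intro x
    have h := l5k_duality g f (fun y => 2 * wf y) (fun y => by rw [hwf]; push_cast; ring) (fun x => 2 * u'' x)
      (fun x => by rw [hu'']; push_cast; ring) x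
    have e2 : ∑ b, (((2 * wf b - 2 * sZ (g b) : ℤ)) : ℝ) * twist b x = 2 * ∑ b, ((e' b : ℤ) : ℝ) * twist b x := by
      rw [mul_sum]; exact sum_congr rfl fun b _ => by simp only [e']; push_cast; ring
    rw [e2] at h
    have : ∑ b, ((e' b : ℤ) : ℝ) * twist b x = -32 * (((2 * u'' x - 2 * sZ (f x) : ℤ)) : ℝ) := by linarith
    rw [this]; simp only [e]; push_cast; ring
  -- the transforms of `π = e − S` and `π′ = e′ − S′`
  have hπhat : ∀ y, ∑ a, (((e a - S a : ℤ)) : ℝ) * twist a y = -64 * (((e' y + sI y : ℤ)) : ℝ) := by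
    intro y
    have h1 : ∑ a, (((e a - S a : ℤ)) : ℝ) * twist a y = ∑ a, ((e a : ℤ) : ℝ) * twist a y - ∑ a, ((S a : ℤ) : ℝ) * twist a y := by
      rw [← sum_sub_distrib]; exact sum_congr rfl fun x _ => by push_cast; ring
    rw [h1, hdual y, hShat y, ← hsI y]; push_cast; ring
  have hπhat' : ∀ x, ∑ b, (((e' b - S' b : ℤ)) : ℝ) * twist b x = -64 * (((e x + sI' x : ℤ)) : ℝ) := by
    intro x
    have h1 : ∑ b, (((e' b - S' b : ℤ)) : ℝ) * twist b x = ∑ b, ((e' b : ℤ) : ℝ) * twist b x - ∑ b, ((S' b : ℤ) : ℝ) * twist b x := by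
      rw [← sum_sub_distrib]; exact sum_congr rfl fun y _ => by push_cast; ring
    rw [h1, hdual' x, hShat' x, ← hsI' x]; push_cast; ring
  -- `ℓ¹` budgets: `Σ|e − S| ≤ 191`, `Σ|e′ − S′| ≤ 191`
  have hmod4 : ∀ x ∈ Z, (4 : ℤ) ∣ e x - sZ (hb x) := fun x hx => tza_mod4 f u'' hx
  have hmod4' : ∀ y ∈ Z', (4 : ℤ) ∣ e' y - sZ (hb' y) := fun y hy => tza_mod4 g wf hy
  have hl1 : (∑ x, |e x - S x| : ℤ) ≤ 191 := by
    have hpt : ∀ x, 2 * |e x - S x| ≤ e x ^ 2 - (if x ∈ Z then 1 else 0) := by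
      intro x
      by_cases hx : x ∈ Z
      · simp only [S]; rw [if_pos hx, if_pos hx]; exact tzb_l1_on (tp_sZ_cases (hb x)) (hmod4 x hx)
      · simp only [S]; rw [if_neg hx, if_neg hx]; exact tzb_l1_off (heeven x hx)
    have hsum : 2 * ∑ x, |e x - S x| ≤ ∑ x, (e x ^ 2 - (if x ∈ Z then 1 else 0) : ℤ) := by
      rw [mul_sum]; exact sum_le_sum fun x _ => hpt x
    have hind : ∑ x, (if x ∈ Z then (1 : ℤ) else 0) = 512 := by
      rw [sum_boole]
      have : (univ.filter fun x => x ∈ Z) = Z := by ext x; simp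
      rw [this, hZ]; norm_num
    rw [sum_sub_distrib, hind] at hsum
    linarith
  have hl1' : (∑ y, |e' y - S' y| : ℤ) ≤ 191 := by
    have hpt : ∀ y, 2 * |e' y - S' y| ≤ e' y ^ 2 - (if y ∈ Z' then 1 else 0) := by
      intro y
      by_cases hy : y ∈ Z'
      · simp only [S']; rw [if_pos hy, if_pos hy]; exact tzb_l1_on (tp_sZ_cases (hb' y)) (hmod4' y hy)
      · simp only [S']; rw [if_neg hy, if_neg hy]; exact tzb_l1_off (he'even y hy)
    have hsum : 2 * ∑ y, |e' y - S' y| ≤ ∑ y, (e' y ^ 2 - (if y ∈ Z' then 1 else 0) : ℤ) := by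
      rw [mul_sum]; exact sum_le_sum fun y _ => hpt y
    have hind : ∑ y, (if y ∈ Z' then (1 : ℤ) else 0) = 512 := by
      rw [sum_boole]
      have : (univ.filter fun y => y ∈ Z') = Z' := by ext y; simp
      rw [this, hZ']; norm_num
    rw [sum_sub_distrib, hind, hBB] at hsum
    linarith
  -- the partner residual is `−s + δ`, `|δ| ≤ 2`
  have hδ : ∀ y, |e' y + sI y| ≤ 2 := by
    intro y
    have habs := tzd_abs_charsum_le (fun a => e a - S a) y
    beta_reduce at habs
    rw [hπhat y] at habs
    have hint : |(-64 : ℝ) * (((e' y + sI y : ℤ)) : ℝ)| ≤ 191 := habs.trans (by exact_mod_cast hl1)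
    rw [abs_mul] at hint
    norm_num at hint
    have h3 : |((e' y : ℤ) : ℝ) + ((sI y : ℤ) : ℝ)| < 3 := by linarith
    have h3' : |e' y + sI y| < 3 := by exact_mod_cast h3
    have h4 := abs_lt.1 h3'
    exact abs_le.2 ⟨by omega, by omega⟩
  have hδ' : ∀ x, |e x + sI' x| ≤ 2 := by
    intro x
    have habs := tzd_abs_charsum_le (fun b => e' b - S' b) x
    beta_reduce at habs
    rw [hπhat' x] at habs
    have hint : |(-64 : ℝ) * (((e x + sI' x : ℤ)) : ℝ)| ≤ 191 := habs.trans (by exact_mod_cast hl1')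
    rw [abs_mul] at hint
    norm_num at hint
    have h3 : |((e x : ℤ) : ℝ) + ((sI' x : ℤ) : ℝ)| < 3 := by linarith
    have h3' : |e x + sI' x| < 3 := by exact_mod_cast h3
    have h4 := abs_lt.1 h3'
    exact abs_le.2 ⟨by omega, by omega⟩
  -- Parseval for `π` and `π′`
  have hPars : (∑ y, (e' y + sI y) ^ 2 : ℤ) = ∑ x, (e x - S x) ^ 2 := by
    have hP := sum_W_sq (fun a => (((e a - S a : ℤ)) : ℝ))
    have hW : ∀ y, W (fun a => (((e a - S a : ℤ)) : ℝ)) y = -64 * (((e' y + sI y : ℤ)) : ℝ) := fun y => hπhat y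
    simp_rw [hW] at hP
    have h' : ((∑ y, (e' y + sI y) ^ 2 : ℤ) : ℝ) = ((∑ x, (e x - S x) ^ 2 : ℤ) : ℝ) := by
      have lhs : ∑ y, (-64 * (((e' y + sI y : ℤ)) : ℝ)) ^ 2 = 4096 * ((∑ y, (e' y + sI y) ^ 2 : ℤ) : ℝ) := by
        rw [Int.cast_sum, mul_sum]; exact sum_congr rfl fun y _ => by rw [Int.cast_pow]; ring
      have rhs : (2 : ℝ) ^ (6 + 6) * ∑ x, ((((e x - S x : ℤ)) : ℝ)) ^ 2 = 4096 * ((∑ x, (e x - S x) ^ 2 : ℤ) : ℝ) := by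
        rw [Int.cast_sum, show ((2 : ℝ) ^ (6 + 6)) = 4096 by norm_num]
        congr 1
        exact sum_congr rfl fun x _ => (Int.cast_pow _ _).symm
      rw [lhs, rhs] at hP
      linarith
    exact_mod_cast h'
  have hPars' : (∑ x, (e x + sI' x) ^ 2 : ℤ) = ∑ y, (e' y - S' y) ^ 2 := by
    have hP := sum_W_sq (fun b => (((e' b - S' b : ℤ)) : ℝ))
    have hW : ∀ x, W (fun b => (((e' b - S' b : ℤ)) : ℝ)) x = -64 * (((e x + sI' x : ℤ)) : ℝ) := fun x => hπhat' x
    simp_rw [hW] at hP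
    have h' : ((∑ x, (e x + sI' x) ^ 2 : ℤ) : ℝ) = ((∑ y, (e' y - S' y) ^ 2 : ℤ) : ℝ) := by
      have lhs : ∑ x, (-64 * (((e x + sI' x : ℤ)) : ℝ)) ^ 2 = 4096 * ((∑ x, (e x + sI' x) ^ 2 : ℤ) : ℝ) := by
        rw [Int.cast_sum, mul_sum]; exact sum_congr rfl fun x _ => by rw [Int.cast_pow]; ring
      have rhs : (2 : ℝ) ^ (6 + 6) * ∑ y, ((((e' y - S' y : ℤ)) : ℝ)) ^ 2 = 4096 * ((∑ y, (e' y - S' y) ^ 2 : ℤ) : ℝ) := by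
        rw [Int.cast_sum, show ((2 : ℝ) ^ (6 + 6)) = 4096 by norm_num]
        congr 1
        exact sum_congr rfl fun y _ => (Int.cast_pow _ _).symm
      rw [lhs, rhs] at hP
      linarith
    exact_mod_cast h'
  -- the pointwise inequalities, summed
  have hptx : ∀ x, 3 * (if x ∈ Z then (1 : ℤ) else 0) + 32 * (if sI' x = 0 then (0 : ℤ) else 1) ≤
      2 * e x ^ 2 - ((e x - S x) ^ 2 - (e x + sI' x) ^ 2) := by
    intro x
    by_cases hx : x ∈ Z
    · simp only [S]; rw [if_pos hx, if_pos hx, mul_one]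
      exact tzb_pt_on (e x) (sI' x) (heodd x hx) (hsI'v x) (hδ' x)
    · simp only [S]; rw [if_neg hx, if_neg hx, mul_zero, zero_add]
      exact tzb_pt_off (e x) (sI' x) (heeven x hx) (hsI'v x) (hδ' x)
  have hpty : ∀ y, 3 * (if y ∈ Z' then (1 : ℤ) else 0) + 32 * (if sI y = 0 then (0 : ℤ) else 1) ≤
      2 * e' y ^ 2 - ((e' y - S' y) ^ 2 - (e' y + sI y) ^ 2) := by
    intro y
    by_cases hy : y ∈ Z'
    · simp only [S']; rw [if_pos hy, if_pos hy, mul_one]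
      exact tzb_pt_on (e' y) (sI y) (heodd' y hy) (hsIv y) (hδ y)
    · simp only [S']; rw [if_neg hy, if_neg hy, mul_zero, zero_add]
      exact tzb_pt_off (e' y) (sI y) (he'even y hy) (hsIv y) (hδ y)
  have hindZ : ∑ x, (if x ∈ Z then (1 : ℤ) else 0) = 512 := by
    rw [sum_boole]
    have : (univ.filter fun x => x ∈ Z) = Z := by ext x; simp
    rw [this, hZ]; norm_num
  have hindZ' : ∑ y, (if y ∈ Z' then (1 : ℤ) else 0) = 512 := by
    rw [sum_boole]
    have : (univ.filter fun y => y ∈ Z') = Z' := by ext y; simp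
    rw [this, hZ']; norm_num
  have hinds' : ∑ x, (if sI' x = 0 then (0 : ℤ) else 1) = 8 := by
    have e1 : ∀ x, (if sI' x = 0 then (0 : ℤ) else 1) = if M' x ≠ 0 then 1 else 0 := by
      intro x
      by_cases h : sI' x = 0
      · rw [if_pos h, if_neg (not_not.2 ((hsI'0 x).1 h))]
      · rw [if_neg h, if_pos (fun h' => h ((hsI'0 x).2 h'))]
    rw [sum_congr rfl fun x _ => e1 x, sum_boole, hM'supp]; norm_num
  have hinds : ∑ y, (if sI y = 0 then (0 : ℤ) else 1) = 8 := by
    have e1 : ∀ y, (if sI y = 0 then (0 : ℤ) else 1) = if M y ≠ 0 then 1 else 0 := by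
      intro y
      by_cases h : sI y = 0
      · rw [if_pos h, if_neg (not_not.2 ((hsI0 y).1 h))]
      · rw [if_neg h, if_pos (fun h' => h ((hsI0 y).2 h'))]
    rw [sum_congr rfl fun y _ => e1 y, sum_boole, hMsupp]; norm_num
  have hsumx : (1792 : ℤ) ≤ 2 * ∑ x, e x ^ 2 - (∑ x, (e x - S x) ^ 2 - ∑ x, (e x + sI' x) ^ 2) := by
    have h := sum_le_sum fun x (_ : x ∈ (univ : Finset (Fin (6 + 6) → Bool))) => hptx x
    rw [sum_add_distrib, ← mul_sum, ← mul_sum, hindZ, hinds', sum_sub_distrib, ← mul_sum, sum_sub_distrib] at h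
    linarith
  have hsumy : (1792 : ℤ) ≤ 2 * ∑ y, e' y ^ 2 - (∑ y, (e' y - S' y) ^ 2 - ∑ y, (e' y + sI y) ^ 2) := by
    have h := sum_le_sum fun y (_ : y ∈ (univ : Finset (Fin (6 + 6) → Bool))) => hpty y
    rw [sum_add_distrib, ← mul_sum, ← mul_sum, hindZ', hinds, sum_sub_distrib, ← mul_sum, sum_sub_distrib] at h
    linarith
  rw [hBB] at hsumy
  rw [hPars] at hsumy
  rw [hPars'] at hsumx
  linarith

/-- **Two cubics on 12 bits at level `≥ 6` have `Φ ≤ 57/64` unless `Φ = 1`** (tight: `Negative/F8ChainTwelve` has `Φ = 57/64` with both sides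
at level `6`).  Finite-slice statement, NOT summit progress. [this work] -/
theorem tz_levelSix_both_le_5764 (f g : (Fin (6 + 6) → Bool) → Bool) (hf : IsDegLeFun 3 f) (hg : IsDegLeFun 3 g)
    (u'' : (Fin (6 + 6) → Bool) → ℤ) (hu'' : ∀ x, W (fun y => signOf (g y)) x = (2 : ℝ) ^ 6 * (u'' x : ℝ))
    (wf : (Fin (6 + 6) → Bool) → ℤ) (hwf : ∀ y, W (fun x => signOf (f x)) y = (2 : ℝ) ^ 6 * (wf y : ℝ))
    (hhi : forrelation f g < 1) : forrelation f g ≤ 57 / 64 := by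
  by_contra h
  push Not at h
  exact tz_levelSix_both_window_false f g hf hg u'' hu'' wf hwf h hhi

/-- **Isolation at `57/64` in the level-`≥ 6` × level-`≥ 6` class**: cubic `f, g` on 12 bits with `W_f, W_g ∈ 64ℤ` and `Φ > 57/64`
have `Φ = 1`.  Finite-slice statement, NOT summit progress. [this work] -/
theorem tz_levelSix_both_isolation (f g : (Fin (6 + 6) → Bool) → Bool) (hf : IsDegLeFun 3 f) (hg : IsDegLeFun 3 g)
    (u'' : (Fin (6 + 6) → Bool) → ℤ) (hu'' : ∀ x, W (fun y => signOf (g y)) x = (2 : ℝ) ^ 6 * (u'' x : ℝ))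
    (wf : (Fin (6 + 6) → Bool) → ℤ) (hwf : ∀ y, W (fun x => signOf (f x)) y = (2 : ℝ) ^ 6 * (wf y : ℝ))
    (hlo : (57 / 64 : ℝ) < forrelation f g) : forrelation f g = 1 := by
  have hle : forrelation f g ≤ 1 := (abs_le.1 (SgnForrMem.abs_forrelation_le_one f g)).2
  rcases eq_or_lt_of_le hle with h | h
  · exact h
  · exact absurd h (fun hhi => tz_levelSix_both_window_false f g hf hg u'' hu'' wf hwf hlo hhi)

end Summit.QuantumAdvantage.QuantumAdvantage.Theorems.CubicForrelation.NearExactIsExact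

end
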